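import Literature.Computability.Cryptography.BranchingProgramEncoding
import Literature.Computability.Complexity.PolynomialEntropyApproximation
import Literature.Computability.Complexity.RandomizingPolynomialsBDD
import Summits.PneNP.PneNP.Theorems.SzkEntropyPeaThreeNotInPStubTransfer
import HarnessLib


/-!
# Crux `PeaThreeNotInP` (stmt-PneNP-10776), line `SketchIdeator3` — SOCKET RIDER skeleton (c1 seat)

DEV CONCATENATION published for the disprover / consult: [pending Literature defs p97525
`BranchingProgramEntropy`] ++ [pending raw defs p98325 `…SocketRawDefs`] ++ [the 7 registered worker
stubs, sorried: stub_encodeBDDsRawFP, stub_toPEARawFP, stub_parityRaw_valid, stub_parityRaw_fn,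
stub_toPEABPRawFP, stub_toPED_mem, stub_toPEDRawFP] ++ [the lead's bridge + assembly, sorry-free:
`PEABP_polyTimeReducible_PEA_three`, `PEA_polyTimeReducible_PEABP`, `peaThreeNotInP_iff_PEABP_not_mem`,
`PEDBP_polyTimeReducible_PED_three`, `peaThreeNotInP_of_PEDBP_not_mem`, `not_peaThreeMemBPP_of_PEDBP`].
The rider does not close the crux (it re-expresses it: X ↔ PEABP ∉ PromiseP, and PEDBP ∉ PromiseP → X);
seat -1's `Lines/SketchIdeator3.lean` remains the line's composition (C⁺ = TensorIsoFull ∉ PromiseP).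
-/

/-!
# Entropy Approximation and Entropy Difference for branching-program samplers (`PEABP`, `PEDBP`)

The entropy problems of Goldreich–Sahai–Vadhan / Goldreich–Vadhan (`EA`, `ED`) restricted to maps
`f : {0,1}ⁿ → {0,1}^ℓ` whose output bits are computed by DETERMINISTIC BRANCHING PROGRAMS, the
representation through which Dvir–Gutfreund–Rothblum–Vadhan route every logarithmic-space sampler
into degree-3 polynomial maps [DGRV 2010, §4.2, Thm 4.5–4.6: a branching program of size `s` has a
perfect randomized encoding of degree `3` over `F₂`, so the entropy difference problem for
branching-program samplers Karp-reduces to `PED_{F₂,3}`; §4.3, Thm 4.7: hence `PED_{F₂,3}` and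
`PEA_{F₂,3}` are complete for `SZKP_L`; the same representation is the `EA_BP` / `ED_BP` of
Allender–Gray–Mutreja–Tirumala–Wang 2025, §2].

* `RawBPNode = ℕ × ℕ × ℕ × ℕ`, `RawBP = List RawBPNode` — the INSTANCE FORMAT: node `i` of a program
  is its `i`-th entry `(tag, x, lo, hi)`; `tag = 0` a `0`-sink, `tag = 1` a `1`-sink, `tag ≥ 2` a
  decision node testing variable `x` with `0`-successor `lo` and `1`-successor `hi`; a program is
  VALID for `n` variables (`RawBP.Valid`, decidable) when it is non-empty and every decision node
  `i` has `x < n`, `lo < i`, `hi < i` (the topological order of the tree's `BDD`,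
  `BinaryDecisionDiagrams.lean`); its root is the LAST node.  `RawBP.compile n B : Σ s, BDD (Fin n) s`
  is the typed program (`RawBP.toBDD`) of a valid `B` and the one-node `0`-sink otherwise, so that
  every string of the format denotes a sampler (no validity promise is needed).
* `bpMap n Bs : F₂ⁿ → List Bool` — the map computed by the programs `Bs` (one output bit each, via
  the tree's `fnList` / `toInput` of `BranchingProgramEncoding.lean`), `bpEntropy n Bs = H(bpMap(U_n))`
  (Shannon entropy in bits of the output on a uniform input, `mapEntropy`).
* `PEABPInst = ℕ × List RawBP × ℕ` (variables `n` in binary, programs, threshold `k` in binary),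
  `PEABPInst.encoding`, `PEABP` (YES `H ≥ k + 1`, NO `H ≤ k` — the gap convention of the tree's
  `PEA d`); `PEDBPInst`, `PEDBPInst.encoding`, `PEDBP` (YES `H(p) ≥ H(q) + 1`, NO `H(p) + 1 ≤ H(q)` —
  the convention of the tree's `PED d`); unfolding lemmas, disjointness, `bpEntropy_le_length`.
* `PEABPInst.toPEA` — the instance map of DGRV Thm 4.6 on the `PEA` side,
  `(n, Bs, k) ↦ (n + m, encodeBDDsMap n (compile Bs), k + m)` with `m` the number of random bits of
  the tree's AIK encoding, and its correctness `toPEA_mem_yes` / `toPEA_mem_no` (YES ↦ YES of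
  `PEA 3`, NO ↦ NO), from `entropy_encodeBDDsMap` (`H = H(f) + m`) and `degLE_three_encodeBDDsMap`.
  The polynomial-time clause (a `CodeFP` program for `toPEA` on codes) and the converse reduction
  `PEA d ≤ₚ PEABP` (parity branching programs of sparse polynomials) are separate files.

## Design notes

* Raw naturals rather than a dependent encoding of the structure `BDD X s` (which carries an
  acyclicity proof): the Boolean code is the plain tuple code `pairBool`/`listBool`/`encodingNatBool`
  of the tree, and the typed program is recovered by `compile`; invalid strings are harmless
  constant samplers.  This is the format the `CodeFP` kit reads (`natE`, `pairE`, `listE`).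
* One output bit per program (as in DGRV §4.2 and `encodeBDDsMap`); multi-output programs are lists.
* Not here: nondeterministic / parity (mod-2) branching programs (AIK Lemma 4.15 in full
  generality; the tree's encoding is the deterministic case), the classes `SZKP_L` / `NISZK_L`.

## References

* Z. Dvir, D. Gutfreund, G. N. Rothblum, S. Vadhan, *On approximating the entropy of polynomial
  mappings*, ECCC TR10-160 (2010) / ICS 2011, §4.2 (Thm 4.5, Thm 4.6), §4.3 (Thm 4.7), Claim 4.4.
  bib `DvirGutfreundRothblumVadhan2010`.
* E. Allender, J. Gray, S. Mutreja, H. Tirumala, P. Wang, *Robustness for space-bounded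
  statistical zero knowledge*, 2025, §2 (`EA_BP`, `ED_BP`), Lemma 10.
* O. Goldreich, A. Sahai, S. Vadhan, CRYPTO 1999 (`EA`); O. Goldreich, S. Vadhan, CCC 1999 (`ED`).
-/

namespace Literature.Computability.Complexity

open _root_.Computability Literature.InformationTheory.Entropy Finset
open Literature.Computability.Cryptography (toInput fnList freshBDDs encodeBDDsMap
  entropy_encodeBDDsMap degLE_three_encodeBDDsMap)

/-! ### Raw branching programs -/

/-- A raw node `(tag, x, lo, hi)`: `tag = 0` the `0`-sink, `tag = 1` the `1`-sink, `tag ≥ 2` a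
decision node testing variable `x` with `0`-successor `lo` and `1`-successor `hi` (node indices).
[DGRV 2010, §4.2 (branching programs); Wegener 2000, Def. 1.1] [cite: DvirGutfreundRothblumVadhan2010, §4.2] -/
abbrev RawBPNode : Type := ℕ × ℕ × ℕ × ℕ

/-- A raw deterministic branching program: the list of its nodes, node `i` the `i`-th entry, in
topological order (successors have smaller index), root the last node.
[DGRV 2010, §4.2; Wegener 2000, Def. 1.1] [cite: DvirGutfreundRothblumVadhan2010, §4.2] -/
abbrev RawBP : Type := List RawBPNode

namespace RawBP

/-- Well-formedness of the node at position `i` of a program over `n` variables: a decision node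
(`tag ≥ 2`) tests a variable `< n` and points to earlier nodes. [folklore] -/
def nodeOK (n i : ℕ) (nd : RawBPNode) : Bool :=
  decide (nd.1 < 2) || (decide (nd.2.1 < n) && decide (nd.2.2.1 < i) && decide (nd.2.2.2 < i))

/-- A raw program is VALID for `n` variables: non-empty and every node well-formed at its
position. [folklore] -/
def Valid (n : ℕ) (B : RawBP) : Prop :=
  0 < B.length ∧ ∀ i : Fin B.length, nodeOK n i.val B[i] = true

/-- Validity is decidable (a finite conjunction of numeral comparisons). [folklore] -/
instance (n : ℕ) (B : RawBP) : Decidable (Valid n B) := by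
  unfold Valid; infer_instance

/-- A well-formed decision node has its data in range. [folklore] -/
theorem nodeOK_branch {n i : ℕ} {nd : RawBPNode} (h : nodeOK n i nd = true) (h2 : 2 ≤ nd.1) :
    nd.2.1 < n ∧ nd.2.2.1 < i ∧ nd.2.2.2 < i := by
  simp only [nodeOK, Bool.or_eq_true, decide_eq_true_eq, Bool.and_eq_true] at h
  omega

/-- The typed node at position `i` of a valid raw program. [folklore] -/
def nodeOf (n : ℕ) (B : RawBP) (h : Valid n B) (i : Fin B.length) : BDD.Node (Fin n) B.length :=
  if h2 : 2 ≤ (B[i]).1 then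
    .branch ⟨(B[i]).2.1, (nodeOK_branch (h.2 i) h2).1⟩
      ⟨(B[i]).2.2.1, lt_trans (nodeOK_branch (h.2 i) h2).2.1 i.isLt⟩
      ⟨(B[i]).2.2.2, lt_trans (nodeOK_branch (h.2 i) h2).2.2 i.isLt⟩
  else .leaf (decide ((B[i]).1 = 1))

/-- Successors of typed nodes are earlier. [folklore] -/
theorem lt_of_mem_children_nodeOf (n : ℕ) (B : RawBP) (h : Valid n B) (i : Fin B.length) :
    ∀ j ∈ (nodeOf n B h i).children, j < i := by
  intro j hj
  unfold nodeOf at hj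
  split_ifs at hj with h2
  · have hb := nodeOK_branch (h.2 i) h2
    simp only [BDD.Node.children, List.mem_cons, List.not_mem_nil, or_false] at hj
    rcases hj with rfl | rfl
    · exact Fin.mk_lt_of_lt_val hb.2.1
    · exact Fin.mk_lt_of_lt_val hb.2.2
  · simp [BDD.Node.children] at hj

/-- **The typed branching program of a valid raw program** (the tree's `BDD` over the variables
`Fin n`, `s = |B|` nodes, root the last node). [DGRV 2010, §4.2] [cite: DvirGutfreundRothblumVadhan2010, §4.2] -/
def toBDD (n : ℕ) (B : RawBP) (h : Valid n B) : BDD (Fin n) B.length where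
  node := nodeOf n B h
  lt_of_mem_children := lt_of_mem_children_nodeOf n B h
  root := ⟨B.length - 1, Nat.sub_lt h.1 Nat.one_pos⟩

/-- The one-node program computing the constant `false`. [folklore] -/
def falseBDD (X : Type) : BDD X 1 where
  node := fun _ => .leaf false
  lt_of_mem_children := fun i j hj => by simp [BDD.Node.children] at hj
  root := 0

/-- The constant-`false` program computes `false`. [folklore] -/
@[simp] theorem falseBDD_fn (X : Type) (z : X → Bool) : (falseBDD X).fn z = false :=
  BDD.eval_of_leaf rfl

/-- **Compilation**: a valid raw program denotes its typed program, an invalid one the constant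
`false` (so every raw program denotes a sampler). [folklore] -/
def compile (n : ℕ) (B : RawBP) : Σ s, BDD (Fin n) s :=
  if h : Valid n B then ⟨B.length, toBDD n B h⟩ else ⟨1, falseBDD (Fin n)⟩

/-- Compilation of a valid program. [folklore] -/
theorem compile_of_valid {n : ℕ} {B : RawBP} (h : Valid n B) :
    compile n B = ⟨B.length, toBDD n B h⟩ := by
  simp [compile, h]

/-- Compilation of an invalid program. [folklore] -/
theorem compile_of_not_valid {n : ℕ} {B : RawBP} (h : ¬ Valid n B) :
    compile n B = ⟨1, falseBDD (Fin n)⟩ := by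
  simp [compile, h]

/-- The size of the compiled program: `|B|` if valid, `1` otherwise — at most `max |B| 1`.
[folklore] -/
theorem compile_fst_le (n : ℕ) (B : RawBP) : (compile n B).1 ≤ max B.length 1 := by
  by_cases h : Valid n B
  · rw [compile_of_valid h]; exact le_max_left _ _
  · rw [compile_of_not_valid h]; exact le_max_right _ _

end RawBP

/-! ### The sampler of a list of programs and its entropy -/

/-- The typed programs of a list of raw programs over `n` variables. [folklore] -/
def compileAll (n : ℕ) (Bs : List RawBP) : List (Σ s, BDD (Fin n) s) :=
  Bs.map (RawBP.compile n)

/-- The number of programs is preserved. [folklore] -/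
@[simp] theorem length_compileAll (n : ℕ) (Bs : List RawBP) : (compileAll n Bs).length = Bs.length := by
  simp [compileAll]

/-- **The map `F₂ⁿ → {0,1}^ℓ` sampled by a list of `ℓ` branching programs** (output bit `j` =
the bit computed by program `j` on the input read as a Boolean assignment).
[DGRV 2010, §4.2] [cite: DvirGutfreundRothblumVadhan2010, §4.2] -/
def bpMap (n : ℕ) (Bs : List RawBP) : (Fin n → ZMod 2) → List Bool :=
  fun x => fnList (compileAll n Bs) (toInput x)

/-- Every output has `ℓ = |Bs|` bits. [folklore] -/
@[simp] theorem length_bpMap (n : ℕ) (Bs : List RawBP) (x : Fin n → ZMod 2) :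
    (bpMap n Bs x).length = Bs.length := by
  simp [bpMap, fnList, compileAll]

/-- **The output entropy `H(f(U_n))` in bits of a branching-program sampler** on a uniform input.
[DGRV 2010, §2 Def 2.1 and §4.2] [cite: DvirGutfreundRothblumVadhan2010, §4.2] -/
noncomputable def bpEntropy (n : ℕ) (Bs : List RawBP) : ℝ :=
  mapEntropy (Finset.univ : Finset (Fin n → ZMod 2)) (bpMap n Bs)

/-- The output entropy is non-negative. [Cover–Thomas, 2nd ed., Lemma 2.1.1] [folklore] -/
theorem bpEntropy_nonneg (n : ℕ) (Bs : List RawBP) : 0 ≤ bpEntropy n Bs :=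
  mapEntropy_nonneg _ _

/-- **`H(f(U_n)) ≤ ℓ`**: the output entropy of `ℓ` programs is at most `ℓ` bits (at most `2^ℓ`
outputs). [Cover–Thomas, 2nd ed., Thm 2.6.4] [folklore] -/
theorem bpEntropy_le_length (n : ℕ) (Bs : List RawBP) : bpEntropy n Bs ≤ Bs.length := by
  classical
  have hS : (Finset.univ : Finset (Fin n → ZMod 2)).Nonempty := Finset.univ_nonempty
  have hbound : ∀ z : Unit, (((Finset.univ : Finset (Fin n → ZMod 2)).image (bpMap n Bs)).filter
      fun y => (fun _ : List Bool => ()) y = z).card ≤ 2 ^ Bs.length := by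
    intro z
    calc (((Finset.univ : Finset (Fin n → ZMod 2)).image (bpMap n Bs)).filter
            fun y => (fun _ : List Bool => ()) y = z).card
        ≤ ((Finset.univ : Finset (List.Vector Bool Bs.length)).image
            (fun v => v.toList)).card := by
          refine Finset.card_le_card fun y hy => ?_
          rw [Finset.mem_filter, Finset.mem_image] at hy
          obtain ⟨⟨x, -, rfl⟩, -⟩ := hy
          exact Finset.mem_image.2 ⟨⟨bpMap n Bs x, length_bpMap n Bs x⟩, Finset.mem_univ _, rfl⟩
      _ ≤ (Finset.univ : Finset (List.Vector Bool Bs.length)).card := Finset.card_image_le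
      _ = 2 ^ Bs.length := by rw [Finset.card_univ, card_vector, Fintype.card_bool]
  have h := mapEntropy_sub_le_mapEntropy_comp hS (bpMap n Bs) (fun _ : List Bool => ()) Bs.length
    hbound
  have h0 : mapEntropy (Finset.univ : Finset (Fin n → ZMod 2)) ((fun _ : List Bool => ()) ∘ bpMap n Bs)
      = 0 := mapEntropy_const _ ()
  unfold bpEntropy
  linarith

/-! ### The promise problems -/

/-- The Boolean code of a raw node: the tuple code of four binary numerals.
[Arora–Barak 2009, §0.1] [cite: AroraBarak2009, §0.1] -/
def RawBPNode.encoding : Encoding RawBPNode Bool :=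
  encodingNatBool.pairBool (encodingNatBool.pairBool (encodingNatBool.pairBool encodingNatBool))

/-- The Boolean code of a raw program: the headed list of its node codes.
[Arora–Barak 2009, §0.1] [cite: AroraBarak2009, §0.1] -/
def RawBP.encoding : Encoding RawBP Bool :=
  RawBPNode.encoding.listBool

/-- Instances of `PEABP`: the number of variables `n`, the programs, the threshold `k`.
[DGRV 2010, §3 p. 6 (`EA`-type instances) and §4.2] [cite: DvirGutfreundRothblumVadhan2010, §4.2] -/
abbrev PEABPInst : Type := ℕ × List RawBP × ℕ

/-- The Boolean code of `PEABP` instances: `n` in binary, the headed list of program codes, `k`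
in binary. [Arora–Barak 2009, §0.1] [cite: AroraBarak2009, §0.1] -/
def PEABPInst.encoding : Encoding PEABPInst Bool :=
  encodingNatBool.pairBool (RawBP.encoding.listBool.pairBool encodingNatBool)

/-- **Entropy Approximation for branching-program samplers**, `PEABP` (Shannon entropy, integer
thresholds, gap `1` — the convention of the tree's `PEA d`): on instances `(n, Bs, k)`, YES iff
`H(f(U_n)) ≥ k + 1`, NO iff `H(f(U_n)) ≤ k`, `f` the map sampled by the programs `Bs`.
[DGRV 2010, §3 p. 6 (`EA` / `PEA`) with the samplers of §4.2; AGMTW 2025, §2 (`EA_BP`)]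
[cite: DvirGutfreundRothblumVadhan2010, §4.2] -/
noncomputable def PEABP : PromiseProblem :=
  PromiseProblem.ofEncoding PEABPInst.encoding
    {I | (I.2.2 : ℝ) + 1 ≤ bpEntropy I.1 I.2.1}
    {I | bpEntropy I.1 I.2.1 ≤ (I.2.2 : ℝ)}

/-- Instances of `PEDBP`: two samplers `(n, Bs)`, `(n', Bs')`, each with its own number of
variables. [DGRV 2010, Def 3.1 (`ED`) with the samplers of §4.2] [cite: DvirGutfreundRothblumVadhan2010, §4.2] -/
abbrev PEDBPInst : Type := (ℕ × List RawBP) × (ℕ × List RawBP)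

/-- The Boolean code of `PEDBP` instances: the pair of the two sampler codes.
[Arora–Barak 2009, §0.1] [cite: AroraBarak2009, §0.1] -/
def PEDBPInst.encoding : Encoding PEDBPInst Bool :=
  (encodingNatBool.pairBool RawBP.encoding.listBool).pairBool
    (encodingNatBool.pairBool RawBP.encoding.listBool)

/-- **Entropy Difference for branching-program samplers**, `PEDBP` (Shannon entropy on both
sides, additive gap `1` — the convention of the tree's `PED d`): on pairs `(p, q)` of samplers,
YES iff `H(p(U)) ≥ H(q(U)) + 1`, NO iff `H(p(U)) + 1 ≤ H(q(U))`.  With logarithmic-space samplers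
this is the `SZKP_L`-complete problem of DGRV; a branching program per output bit is their
normal form of such a sampler. [DGRV 2010, Def 3.1, §4.2–4.3 (Thm 4.6–4.7); AGMTW 2025, §2 (`ED_BP`)]
[cite: DvirGutfreundRothblumVadhan2010, Thm 4.6] -/
noncomputable def PEDBP : PromiseProblem :=
  PromiseProblem.ofEncoding PEDBPInst.encoding
    {I | bpEntropy I.2.1 I.2.2 + 1 ≤ bpEntropy I.1.1 I.1.2}
    {I | bpEntropy I.1.1 I.1.2 + 1 ≤ bpEntropy I.2.1 I.2.2}

/-- Unfolding the yes-instances of `PEABP`: `k + 1 ≤ H`. [DGRV 2010, §3 p. 6] [cite: DvirGutfreundRothblumVadhan2010, §3 p.6] -/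
theorem encode_mem_PEABP_yes_iff (I : PEABPInst) :
    PEABPInst.encoding.encode I ∈ PEABP.yes ↔ (I.2.2 : ℝ) + 1 ≤ bpEntropy I.1 I.2.1 :=
  PEABPInst.encoding.mem_toLanguage_iff _ I

/-- Unfolding the no-instances of `PEABP`: `H ≤ k`. [DGRV 2010, §3 p. 6] [cite: DvirGutfreundRothblumVadhan2010, §3 p.6] -/
theorem encode_mem_PEABP_no_iff (I : PEABPInst) :
    PEABPInst.encoding.encode I ∈ PEABP.no ↔ bpEntropy I.1 I.2.1 ≤ (I.2.2 : ℝ) :=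
  PEABPInst.encoding.mem_toLanguage_iff _ I

/-- Unfolding the yes-instances of `PEDBP`: `H(q) + 1 ≤ H(p)`. [DGRV 2010, Def 3.1] [cite: DvirGutfreundRothblumVadhan2010, Def 3.1] -/
theorem encode_mem_PEDBP_yes_iff (I : PEDBPInst) :
    PEDBPInst.encoding.encode I ∈ PEDBP.yes ↔ bpEntropy I.2.1 I.2.2 + 1 ≤ bpEntropy I.1.1 I.1.2 :=
  PEDBPInst.encoding.mem_toLanguage_iff _ I

/-- Unfolding the no-instances of `PEDBP`: `H(p) + 1 ≤ H(q)`. [DGRV 2010, Def 3.1] [cite: DvirGutfreundRothblumVadhan2010, Def 3.1] -/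
theorem encode_mem_PEDBP_no_iff (I : PEDBPInst) :
    PEDBPInst.encoding.encode I ∈ PEDBP.no ↔ bpEntropy I.1.1 I.1.2 + 1 ≤ bpEntropy I.2.1 I.2.2 :=
  PEDBPInst.encoding.mem_toLanguage_iff _ I

/-- `PEABP` is a disjoint promise problem. [DGRV 2010, Def 3.1 ("do not intersect")] [cite: DvirGutfreundRothblumVadhan2010, Def 3.1] -/
theorem PEABP_disjoint : PEABP.Disjoint := by
  refine PromiseProblem.disjoint_ofEncoding _ (Set.disjoint_left.2 fun I hY hN => ?_)
  simp only [Set.mem_setOf_eq] at hY hN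
  linarith

/-- `PEDBP` is a disjoint promise problem. [DGRV 2010, Def 3.1] [cite: DvirGutfreundRothblumVadhan2010, Def 3.1] -/
theorem PEDBP_disjoint : PEDBP.Disjoint := by
  refine PromiseProblem.disjoint_ofEncoding _ (Set.disjoint_left.2 fun I hY hN => ?_)
  simp only [Set.mem_setOf_eq] at hY hN
  linarith

/-! ### The instance map to `PEA 3` (DGRV Thm 4.6, `PEA` side): semantics -/

namespace PEABPInst

/-- The number of random bits of the AIK encoding of the programs of an instance. [cite: ApplebaumIshaiKushilevitz2006, Lemma 4.15] -/
def fresh (I : PEABPInst) : ℕ := freshBDDs (compileAll I.1 I.2.1)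

/-- **The instance map `PEABP → PEA 3`**: `(n, Bs, k) ↦ (n + m, p̂, k + m)` where `p̂` is the
degree-3 perfect randomized encoding of the sampler with `m` random bits appended to the input.
[DGRV 2010, Thm 4.6 (proof) with Thm 4.5] [cite: DvirGutfreundRothblumVadhan2010, Thm 4.6] -/
def toPEA (I : PEABPInst) : PEAInst :=
  ⟨I.1 + I.fresh, (encodeBDDsMap I.1 (compileAll I.1 I.2.1), I.2.2 + I.fresh)⟩

/-- **Entropy bookkeeping**: the encoded map has entropy `H(f(U_n)) + m`.
[DGRV 2010, Claim 4.4] [cite: DvirGutfreundRothblumVadhan2010, Claim 4.4] -/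
theorem entropy_toPEA (I : PEABPInst) :
    (toPEA I).2.1.entropy = bpEntropy I.1 I.2.1 + I.fresh :=
  entropy_encodeBDDsMap I.1 (compileAll I.1 I.2.1)

/-- The encoded map has degree `≤ 3`. [DGRV 2010, Thm 4.5] [cite: DvirGutfreundRothblumVadhan2010, Thm 4.5] -/
theorem degLE_toPEA (I : PEABPInst) : (toPEA I).2.1.DegLE 3 :=
  degLE_three_encodeBDDsMap I.1 _

/-- **YES ↦ YES**: a yes-instance of `PEABP` is sent to a yes-instance of `PEA 3`.
[DGRV 2010, Thm 4.6] [cite: DvirGutfreundRothblumVadhan2010, Thm 4.6] -/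
theorem toPEA_mem_yes {I : PEABPInst} (hI : PEABPInst.encoding.encode I ∈ PEABP.yes) :
    PEAInst.encoding.encode (toPEA I) ∈ (PEA 3).yes := by
  rw [encode_mem_PEABP_yes_iff] at hI
  rw [encode_mem_PEA_yes_iff]
  refine ⟨degLE_toPEA I, ?_⟩
  rw [entropy_toPEA]
  change (((I.2.2 + I.fresh : ℕ) : ℝ)) + 1 ≤ bpEntropy I.1 I.2.1 + I.fresh
  push_cast
  linarith

/-- **NO ↦ NO**: a no-instance of `PEABP` is sent to a no-instance of `PEA 3`.
[DGRV 2010, Thm 4.6] [cite: DvirGutfreundRothblumVadhan2010, Thm 4.6] -/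
theorem toPEA_mem_no {I : PEABPInst} (hI : PEABPInst.encoding.encode I ∈ PEABP.no) :
    PEAInst.encoding.encode (toPEA I) ∈ (PEA 3).no := by
  rw [encode_mem_PEABP_no_iff] at hI
  rw [encode_mem_PEA_no_iff]
  refine ⟨degLE_toPEA I, ?_⟩
  rw [entropy_toPEA]
  change bpEntropy I.1 I.2.1 + I.fresh ≤ (((I.2.2 + I.fresh : ℕ) : ℝ))
  push_cast
  linarith

end PEABPInst

/-! ### A worked instance (non-vacuity): the program of `x₀ ∧ x₁` -/

/-- The raw 4-node program of `x₀ ∧ x₁` over `2` variables: nodes `0: sink 0`, `1: sink 1`,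
`2: test x₁ (lo 0, hi 1)`, `3 (root): test x₀ (lo 0, hi 2)`. [folklore] -/
def andRaw : RawBP := [(0, 0, 0, 0), (1, 0, 0, 0), (2, 1, 0, 1), (2, 0, 0, 2)]

/-- `andRaw` is valid over `2` variables. [folklore] -/
theorem andRaw_valid : RawBP.Valid 2 andRaw := by decide

/-- `andRaw` computes `x₀ ∧ x₁`. [folklore] -/
theorem andRaw_fn (z : Fin 2 → Bool) :
    (RawBP.compile 2 andRaw).2.fn z = (z 0 && z 1) := by
  rw [RawBP.compile_of_valid andRaw_valid]
  set B := RawBP.toBDD 2 andRaw andRaw_valid with hB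
  have e3 : B.node ⟨3, by decide⟩ = .branch 0 ⟨0, by decide⟩ ⟨2, by decide⟩ := by decide
  have e2 : B.node ⟨2, by decide⟩ = .branch 1 ⟨0, by decide⟩ ⟨1, by decide⟩ := by decide
  have e1 : B.node ⟨1, by decide⟩ = .leaf true := by decide
  have e0 : B.node ⟨0, by decide⟩ = .leaf false := by decide
  have h3 := BDD.eval_of_branch (z := z) e3
  have h2 := BDD.eval_of_branch (z := z) e2
  have h1 := BDD.eval_of_leaf (z := z) e1
  have h0 := BDD.eval_of_leaf (z := z) e0
  change B.eval z B.root = _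
  rw [show B.root = ⟨3, by decide⟩ from rfl, h3, h2, h1, h0]
  cases z 0 <;> cases z 1 <;> rfl

end Literature.Computability.Complexity


/-!
# Route SzkEntropy, crux `PeaThreeNotInP` (stmt-PneNP-10776), line `SketchIdeator3`, socket rider:
# raw-level functions of the branching-program socket (definitions only)

The socket rider (card `entropy-gap-sockets`, merged into line `SketchIdeator3` by TRIAGE-r1-1)
certifies, over the tree's degree-3 perfect encoding of deterministic branching programs
(`encodeBDDs`, `encodeBDDsMap`, `entropy_encodeBDDsMap` — Applebaum–Ishai–Kushilevitz Lemma 4.15,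
Dvir–Gutfreund–Rothblum–Vadhan Thm 4.5 / Claim 4.4), the reductions

  `PEABP ≤ₚ PEA 3`,  `PEDBP ≤ₚ PED 3`  (DGRV Thm 4.6)   and   `PEA d ≤ₚ PEABP`  (parity programs),

where `PEABP` / `PEDBP` (entropy approximation / difference for branching-program samplers, raw
node-list instances `RawBP = List (ℕ × ℕ × ℕ × ℕ)`) are the Literature definitions of
`Literature/Computability/Complexity/BranchingProgramEntropy.lean`; hence
`PeaThreeNotInP ↔ PEABP ∉ PromiseP` and `PEDBP ∉ PromiseP → PeaThreeNotInP`.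

This file fixes the RAW-DATA FUNCTIONS (plain lists of naturals, the format the `CodeFP` kit reads)
shared by the socket's stubs, so that the `CodeFP` stubs and the semantic stubs speak about the same
terms:

* §1 `nodeOKRaw`, `validRaw` (validity of a raw program over `n` variables: non-empty, decision
  nodes test a variable `< n` and point to earlier nodes), `symNodeRaw`, `symBPRaw`, `symFalseRaw`
  (the symbolic matrix `L` of AIK Fact 4.13 / Lemma 4.15 read off raw nodes; root = last node;
  the one-node 0-sink for invalid programs), `sizeRaw`, `encodeBDDRaw` (= `gBlock` of the symbolic
  matrix), `encodeBDDsRaw` (consecutive fresh blocks, as `encodeBDDs`), `toPEARaw` (raw data of the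
  instance map `PEABP → PEA 3`, `(n, Bs, k) ↦ (n + m, P', k + m)`).
* §2 `chainRaw`, `parityStep`, `parityRaw` — the PARITY PROGRAM of a sparse polynomial over `F₂`
  (a width-2 layered program: per non-empty monomial two decision chains, one per accumulated
  parity; empty monomials absorbed into the two sinks; root = last node), `toPEABPRaw` (raw data of
  the instance map `PEA d → PEABP`, `(n, P, k) ↦ (n, P.map parityRaw, k)`).
* §3 decidable sanity checks (`socketRawDefs_sanity`).

Raw node format: `(tag, x, lo, hi)`, `tag = 0` the 0-sink, `tag = 1` the 1-sink, `tag ≥ 2` a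
decision node testing `x` with 0-successor `lo` and 1-successor `hi`; node `i` = entry `i`.
Definitions only; the facts (`CodeFP` programs, agreement with `encodeBDDs ∘ compile`, semantics
of `parityRaw`) are the socket's stub files `SzkEntropyPeaThreeNotInPSocket*.lean`.
Sources: B. Applebaum, Y. Ishai, E. Kushilevitz, SIAM J. Comput. 36 (2006) §4.3; Z. Dvir,
D. Gutfreund, G. N. Rothblum, S. Vadhan, ECCC TR10-160 (2010) §4.2; I. Wegener, *Branching
programs and binary decision diagrams*, SIAM 2000, §1.1 (parity as a width-2 program).
-/

namespace Summit.PneNP.PneNP.Cruxes.PeaThreeNotInP.SocketBP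

set_option linter.dupNamespace false -- `Summit.PneNP.PneNP.…`: summit = sub-problem name (D-0017)

open Literature.Computability.Complexity Literature.Computability.Complexity.RandPoly

/-! ### §1 The degree-3 encoding read off raw programs -/

/-- Well-formedness of the raw node `nd` at position `i` over `n` variables (the `Bool` of
`RawBP.nodeOK`): a decision node tests a variable `< n` and points to earlier nodes. [folklore] -/
def nodeOKRaw (n i : ℕ) (nd : ℕ × ℕ × ℕ × ℕ) : Bool :=
  decide (nd.1 < 2) || (decide (nd.2.1 < n) && decide (nd.2.2.1 < i) && decide (nd.2.2.2 < i))

/-- Validity of a raw program over `n` variables as a `Bool` (= `decide (RawBP.Valid n B)`):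
non-empty and every node well-formed at its position. [folklore] -/
def validRaw (n : ℕ) (B : List (ℕ × ℕ × ℕ × ℕ)) : Bool :=
  decide (0 < B.length) && ((List.range B.length).all fun i => nodeOKRaw n i (B.getD i (0, 0, 0, 0)))

/-- Out-edges of a raw node as sparse affine polynomials in the input variables — the raw form
of `RandPoly.symNode Fin.val` on the typed node: `s` = number of nodes, column `c`.
[cite: ApplebaumIshaiKushilevitz2006, Lemma 4.15] -/
def symNodeRaw (nd : ℕ × ℕ × ℕ × ℕ) (s c : ℕ) : List (List ℕ) :=
  if nd.1 < 2 then (if c = s ∧ nd.1 = 1 then [[]] else [])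
  else (if c + 1 + nd.2.2.2 = s then [[nd.2.1]] else []) ++
       (if c + 1 + nd.2.2.1 = s then [[], [nd.2.1]] else [])

/-- The symbolic matrix `L` of a VALID raw program (raw form of `RandPoly.symBP` on the compiled
program: `s = |B|` nodes, root `s - 1`, row `r ↦ node s - r`).
[cite: ApplebaumIshaiKushilevitz2006, Lemma 4.15] -/
def symBPRaw (B : List (ℕ × ℕ × ℕ × ℕ)) (r c : ℕ) : List (List ℕ) :=
  (if r = 0 then (if c + 1 + (B.length - 1) = B.length then [[]] else [])
    else if r ≤ B.length ∧ 0 < r then symNodeRaw (B.getD (B.length - r) (0, 0, 0, 0)) B.length c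
    else []) ++
  (if r = c + 1 then [[]] else [])

/-- The symbolic matrix of the one-node 0-sink program (the compiled form of an invalid raw
program). [cite: ApplebaumIshaiKushilevitz2006, Lemma 4.15] -/
def symFalseRaw (r c : ℕ) : List (List ℕ) :=
  (if r = 0 then (if c = 0 then [[]] else []) else []) ++ (if r = c + 1 then [[]] else [])

/-- Number of nodes of the compiled program: `|B|` if valid, `1` otherwise. [folklore] -/
def sizeRaw (n : ℕ) (B : List (ℕ × ℕ × ℕ × ℕ)) : ℕ := if validRaw n B then B.length else 1

/-- The degree-3 block of one raw program with fresh variables from `n₀` (raw form of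
`RandPoly.encodeBDD n₀ (compile n B).2 Fin.val`). [cite: ApplebaumIshaiKushilevitz2006, Lemma 4.15] -/
def encodeBDDRaw (n₀ n : ℕ) (B : List (ℕ × ℕ × ℕ × ℕ)) : List (List (List ℕ)) :=
  if validRaw n B then gBlock n₀ B.length (symBPRaw B) else gBlock n₀ 1 symFalseRaw

/-- The encoding of a list of raw programs with consecutive fresh blocks from `n₀` (raw form of
`RandPoly.encodeBDDs Fin.val n₀ (compileAll n Bs)`): final counter and outputs.
[cite: ApplebaumIshaiKushilevitz2006, Lemma 4.9] -/
def encodeBDDsRaw (n : ℕ) : ℕ → List (List (ℕ × ℕ × ℕ × ℕ)) → ℕ × List (List (List ℕ))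
  | n₀, [] => (n₀, [])
  | n₀, B :: Bs => ((encodeBDDsRaw n (n₀ + pos (sizeRaw n B) (sizeRaw n B)) Bs).1,
      encodeBDDRaw n₀ n B ++ (encodeBDDsRaw n (n₀ + pos (sizeRaw n B) (sizeRaw n B)) Bs).2)

/-- Raw data of the instance map `PEABP → PEA 3`: `(n, Bs, k) ↦ (n', P', k + (n' - n))` with
`(n', P') = encodeBDDsRaw n n Bs` (`n' - n` = number of random bits).
[cite: DvirGutfreundRothblumVadhan2010, Thm 4.6] -/
def toPEARaw (c : ℕ × List (List (ℕ × ℕ × ℕ × ℕ)) × ℕ) : ℕ × List (List (List ℕ)) × ℕ :=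
  ((encodeBDDsRaw c.1 c.1 c.2.1).1, (encodeBDDsRaw c.1 c.1 c.2.1).2,
    c.2.2 + ((encodeBDDsRaw c.1 c.1 c.2.1).1 - c.1))

/-! ### §2 The parity program of a sparse polynomial -/

/-- The decision chain of a non-empty monomial `μ = [x₁, …, x_d]`, emitted from node index `start`:
chain node `j` (`0`-based) tests `x_{d-j}`; its 0-successor is `kb` ("the monomial vanishes: keep
the accumulated parity"), its 1-successor the previous chain node (`kf` = "flip" for `j = 0`).
The entry of the chain (the test of `x₁`) is the node `start + d - 1`.
[Wegener 2000, §1.1] [folklore] -/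
def chainRaw (μ : List ℕ) (start kb kf : ℕ) : List (ℕ × ℕ × ℕ × ℕ) :=
  (μ.reverse.zipIdx).map fun xj => (2, xj.1, kb, if xj.2 = 0 then kf else start + xj.2 - 1)

/-- One monomial of the parity program: on the state `(nodes so far, k0, k1)` (`k_b` = the node
computing the rest at accumulated parity `b`) emit the chain for parity `1` (keep `k1`, flip to
`k0`) and then the chain for parity `0` (keep `k0`, flip to `k1`); the new continuations are the
two chain entries. [Wegener 2000, §1.1] [folklore] -/
def parityStep (st : List (ℕ × ℕ × ℕ × ℕ) × ℕ × ℕ) (μ : List ℕ) :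
    List (ℕ × ℕ × ℕ × ℕ) × ℕ × ℕ :=
  let s := st.1.length
  let d := μ.length
  (st.1 ++ chainRaw μ s st.2.2 st.2.1 ++ chainRaw μ (s + d) st.2.1 st.2.2, s + 2 * d - 1, s + d - 1)

/-- **The parity program of a sparse polynomial** `p` over `F₂` (a list of monomials, variables as
naturals): node `0` = the sink reached at accumulated parity `1`, node `1` = the sink reached at
accumulated parity `0` (their labels absorb the number of EMPTY monomials, i.e. constant `1`s),
then the chains of the non-empty monomials, last monomial first, so that the root — the entry of
the first monomial at parity `0` — is the last node.  It computes `x ↦ [∑_{μ ∈ p} ∏_{i ∈ μ} xᵢ = 1]`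
with `2 + 2 · ∑_μ |μ|` nodes. [Wegener 2000, §1.1 (parity / linear functions have width-2 OBDDs)] [folklore] -/
def parityRaw (p : List (List ℕ)) : List (ℕ × ℕ × ℕ × ℕ) :=
  let odd : Bool := decide ((p.filter fun μ => μ.isEmpty).length % 2 = 1)
  let q := p.filter fun μ => !μ.isEmpty
  (q.reverse.foldl parityStep
    ([(if odd then 0 else 1, 0, 0, 0), (if odd then 1 else 0, 0, 0, 0)], 1, 0)).1

/-- Raw data of the instance map `PEA d → PEABP`: `(n, P, k) ↦ (n, P.map parityRaw, k)`.
[folklore] -/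
def toPEABPRaw (c : ℕ × List (List (List ℕ)) × ℕ) : ℕ × List (List (ℕ × ℕ × ℕ × ℕ)) × ℕ :=
  (c.1, c.2.1.map parityRaw, c.2.2)

/-! ### §3 Sanity checks (decidable) -/

/-- **Sanity of the raw definitions** on the polynomial `x₀x₁ + x₂` over `3` variables: its parity
program is the expected 8-node program, valid over `3` variables; the 4-node program of `x₀ ∧ x₁`
is valid over `2` variables and the empty program is not; the parity programs of `0` and of `1`
are the two sinks in the two orders. [folklore] -/
theorem socketRawDefs_sanity :
    parityRaw [[0, 1], [2]] =
        [(1,0,0,0), (0,0,0,0), (2,2,0,1), (2,2,1,0), (2,1,2,3), (2,0,2,4), (2,1,3,2), (2,0,3,6)] ∧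
      validRaw 3 (parityRaw [[0, 1], [2]]) = true ∧
      validRaw 2 [(0,0,0,0), (1,0,0,0), (2,1,0,1), (2,0,0,2)] = true ∧
      validRaw 2 [] = false ∧
      parityRaw [] = [(1,0,0,0), (0,0,0,0)] ∧ parityRaw [[]] = [(0,0,0,0), (1,0,0,0)] := by
  decide

end Summit.PneNP.PneNP.Cruxes.PeaThreeNotInP.SocketBP

/-! ## DEV ONLY: the four workers' registered stubs, sorried (replaced by imports in the landed file) -/

namespace Summit.PneNP.PneNP.Cruxes.PeaThreeNotInP.SocketBP

open Literature.Computability.Complexity Literature.Computability.Complexity.RandPoly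
open Literature.Computability.Cryptography (freshBDDs encodeBDDsMap)
open CodeFP (natE pairE rawE listE)

theorem stub_encodeBDDsRawFP : CodeFP (pairE natE (pairE natE (rawE (rawE (pairE natE (pairE natE (pairE natE natE))))))) (pairE natE (rawE (rawE (rawE natE)))) (fun c => encodeBDDsRaw c.1 c.2.1 c.2.2) := by
  sorry

theorem stub_toPEARawFP : CodeFP (pairE natE (pairE (listE (listE (pairE natE (pairE natE (pairE natE natE))))) natE)) (pairE natE (pairE (listE (listE (listE natE))) natE)) toPEARaw := by
  sorry

theorem stub_parityRaw_valid {n : ℕ} (p : List (List (Fin n))) : RawBP.Valid n (parityRaw (p.map (List.map Fin.val))) := by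
  sorry

theorem stub_parityRaw_fn {n : ℕ} (p : List (List (Fin n))) (x : Fin n → ZMod 2) : (RawBP.compile n (parityRaw (p.map (List.map Fin.val)))).2.fn (Literature.Computability.Cryptography.toInput x) = decide ((p.map fun μ => (μ.map x).prod).sum = 1) := by
  sorry

theorem stub_toPEABPRawFP : CodeFP (pairE natE (pairE (listE (listE (listE natE))) natE)) (pairE natE (pairE (listE (listE (pairE natE (pairE natE (pairE natE natE))))) natE)) toPEABPRaw := by
  sorry

def prodRaw (N : ℕ) (P Q : List (List (List ℕ))) : List (List (List ℕ)) := P ++ Q.map (List.map (List.map fun i => N + i))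
def idMapRaw (m : ℕ) : List (List (List ℕ)) := (List.range m).map fun i => [[i]]
def toPEDRaw (c : (ℕ × List (List (ℕ × ℕ × ℕ × ℕ))) × (ℕ × List (List (ℕ × ℕ × ℕ × ℕ)))) : (ℕ × List (List (List ℕ))) × (ℕ × List (List (List ℕ))) :=
  (((encodeBDDsRaw c.1.1 c.1.1 c.1.2).1 + ((encodeBDDsRaw c.2.1 c.2.1 c.2.2).1 - c.2.1),
    prodRaw (encodeBDDsRaw c.1.1 c.1.1 c.1.2).1 (encodeBDDsRaw c.1.1 c.1.1 c.1.2).2 (idMapRaw ((encodeBDDsRaw c.2.1 c.2.1 c.2.2).1 - c.2.1))),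
   ((encodeBDDsRaw c.2.1 c.2.1 c.2.2).1 + ((encodeBDDsRaw c.1.1 c.1.1 c.1.2).1 - c.1.1),
    prodRaw (encodeBDDsRaw c.2.1 c.2.1 c.2.2).1 (encodeBDDsRaw c.2.1 c.2.1 c.2.2).2 (idMapRaw ((encodeBDDsRaw c.1.1 c.1.1 c.1.2).1 - c.1.1))))
def toPED (I : PEDBPInst) : PEDInst :=
  (⟨I.1.1 + freshBDDs (compileAll I.1.1 I.1.2) + freshBDDs (compileAll I.2.1 I.2.2),
    (encodeBDDsMap I.1.1 (compileAll I.1.1 I.1.2)).prod (PolyMapF2.idMap (freshBDDs (compileAll I.2.1 I.2.2)))⟩,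
   ⟨I.2.1 + freshBDDs (compileAll I.2.1 I.2.2) + freshBDDs (compileAll I.1.1 I.1.2),
    (encodeBDDsMap I.2.1 (compileAll I.2.1 I.2.2)).prod (PolyMapF2.idMap (freshBDDs (compileAll I.1.1 I.1.2)))⟩)

theorem stub_toPED_mem : (∀ I : PEDBPInst, PEDBPInst.encoding.encode I ∈ PEDBP.yes → PEDInst.encoding.encode (toPED I) ∈ (PED 3).yes) ∧ (∀ I : PEDBPInst, PEDBPInst.encoding.encode I ∈ PEDBP.no → PEDInst.encoding.encode (toPED I) ∈ (PED 3).no) := by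
  sorry

theorem stub_toPEDRawFP (hA : CodeFP (pairE natE (pairE natE (rawE (rawE (pairE natE (pairE natE (pairE natE natE))))))) (pairE natE (rawE (rawE (rawE natE)))) (fun c => encodeBDDsRaw c.1 c.2.1 c.2.2)) : CodeFP (pairE (pairE natE (listE (listE (pairE natE (pairE natE (pairE natE natE)))))) (pairE natE (listE (listE (pairE natE (pairE natE (pairE natE natE))))))) (pairE (pairE natE (listE (listE (listE natE)))) (pairE natE (listE (listE (listE natE))))) toPEDRaw := by
  sorry

end Summit.PneNP.PneNP.Cruxes.PeaThreeNotInP.SocketBP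


/-!
# Route SzkEntropy, crux `PeaThreeNotInP` (stmt-PneNP-10776), line `SketchIdeator3`, socket rider:
# assembly — `PeaThreeNotInP ↔ PEABP ∉ PromiseP`, `PEDBP ∉ PromiseP → PeaThreeNotInP`

The branching-program socket of the line (card `entropy-gap-sockets`, merged as a rider by
TRIAGE-r1-1), assembled from its stubs:

* §1 raw ↔ typed bridge: the raw-data functions of `…SocketRawDefs.lean` ARE the untyped images of
  the tree's AIK encoding of the compiled programs (`symBPRaw_eq`, `encodeBDDRaw_eq`,
  `encodeBDDsRaw_eq`, `rawOf_toPEA`) and the Boolean codes of `PEABP`/`PEDBP` instances are the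
  `CodeFP` tuple codes (`encode_eq_peabpE`, `encode_eq_pedbpE`);
* §2 `PEABP_polyTimeReducible_PEA_three : PEABP ≤ₚ PEA 3` (DGRV Thm 4.6, `PEA` side) from
  `stub_toPEARawFP` + `PEABPInst.toPEA_mem_yes/no`;
* §3 `bpEntropy_parityRaw : H(parity programs of P) = H(P)` from `stub_parityRaw_fn`, and
  `PEA_polyTimeReducible_PEABP : PEA d ≤ₚ PEABP` for every `d` from `stub_toPEABPRawFP`;
* §4 `PEABP_mem_PromiseP_iff : PEABP ∈ PromiseP ↔ PEA 3 ∈ PromiseP`,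
  **`peaThreeNotInP_iff_PEABP_not_mem : PeaThreeNotInP ↔ PEABP ∉ PromiseP`**;
* §5 `PEDBP_polyTimeReducible_PED_three : PEDBP ≤ₚ PED 3` (DGRV Thm 4.6) from `stub_toPEDRawFP`,
  `stub_encodeBDDsRawFP`, `stub_toPED_mem`, and **`peaThreeNotInP_of_PEDBP_not_mem :
  PEDBP ∉ PromiseP → PeaThreeNotInP`** (with the landed `PED 3 ≤_Cook PEA 3`, `stub_pedCookPea`),
  plus the randomised form `not_peaThreeMemBPP_of_PEDBP : PEDBP ∉ PromiseBPP' → ¬ PeaThreeMemBPP`.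

Sources: Z. Dvir, D. Gutfreund, G. N. Rothblum, S. Vadhan, ECCC TR10-160 (2010), Thm 4.5–4.6,
Claim 4.4; B. Applebaum, Y. Ishai, E. Kushilevitz, SIAM J. Comput. 36 (2006), Lemma 4.15;
O. Goldreich, *On promise problems* (2006), Def. 1.2–1.4.
-/

namespace Summit.PneNP.PneNP.Cruxes.PeaThreeNotInP.SocketBP

set_option linter.dupNamespace false -- `Summit.PneNP.PneNP.…`: summit = sub-problem name (D-0017)

open _root_.Computability Finset
open Literature.InformationTheory.Entropy
open Literature.Computability.Complexity Literature.Computability.Complexity.RandPoly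
open Literature.Computability.Cryptography (toInput fnList freshBDDs encodeBDDsMap encodeBDDs_fst_eq)
open CodeFP (natE pairE rawE listE)
open Summit.PneNP.PneNP.Theses.SzkEntropy (PeaThreeNotInP PeaThreeMemBPP)
open Summit.PneNP.PneNP.Theorems (szkEntropy_peaThreeNotInP_iff szkEntropy_peaThreeMemBPP_iff)
open Summit.PneNP.PneNP.Cruxes.PeaThreeNotInP.TensorIsoLine (pedE rawPED encode_eq_pedE natOf_prod
  shiftN stub_pedCookPea)

/-! ### §1 The raw functions are the untyped images of the typed encoding -/

section Bridge

variable {n : ℕ}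

/-- `validRaw` decides `RawBP.Valid`. [folklore] -/
theorem validRaw_eq_true_iff (n : ℕ) (B : RawBP) : validRaw n B = true ↔ RawBP.Valid n B := by
  unfold validRaw RawBP.Valid
  simp only [Bool.and_eq_true, decide_eq_true_eq, List.all_eq_true, List.mem_range]
  refine and_congr_right fun _ => ⟨fun h i => ?_, fun h i hi => ?_⟩
  · have := h i.val i.isLt
    rwa [List.getD_eq_getElem _ _ i.isLt] at this
  · have := h ⟨i, hi⟩
    rwa [List.getD_eq_getElem _ _ hi]

/-- `validRaw` is `false` exactly on invalid programs. [folklore] -/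
theorem validRaw_eq_false_iff (n : ℕ) (B : RawBP) : validRaw n B = false ↔ ¬ RawBP.Valid n B := by
  rw [← validRaw_eq_true_iff, Bool.eq_false_iff]

/-- The raw symbolic node is the symbolic node of the typed node.
[cite: ApplebaumIshaiKushilevitz2006, Lemma 4.15] -/
theorem symNodeRaw_eq (B : RawBP) (h : RawBP.Valid n B) (i : Fin B.length) (c : ℕ) :
    symNodeRaw B[i] B.length c = symNode Fin.val (RawBP.nodeOf n B h i) c := by
  unfold RawBP.nodeOf symNodeRaw symNode
  by_cases h2 : 2 ≤ (B[i]).1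
  · rw [dif_pos h2, if_neg (not_lt.2 h2)]
  · rw [dif_neg h2, if_pos (not_le.1 h2)]
    simp only [decide_eq_true_eq]

/-- The raw symbolic matrix is the symbolic matrix `L` of the typed program.
[cite: ApplebaumIshaiKushilevitz2006, Lemma 4.15] -/
theorem symBPRaw_eq (B : RawBP) (h : RawBP.Valid n B) :
    symBPRaw B = symBP (RawBP.toBDD n B h) Fin.val := by
  funext r c
  unfold symBPRaw symBP
  congr 1
  by_cases hr : r = 0
  · simp only [hr, if_true]
    rfl
  · rw [if_neg hr, if_neg hr]
    by_cases hr' : r ≤ B.length ∧ 0 < r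
    · rw [if_pos hr', dif_pos hr']
      have hlt : B.length - r < B.length := by omega
      rw [List.getD_eq_getElem _ _ hlt]
      exact symNodeRaw_eq B h ⟨B.length - r, hlt⟩ c
    · rw [if_neg hr', dif_neg hr']

/-- The raw symbolic matrix of the one-node 0-sink. [cite: ApplebaumIshaiKushilevitz2006, Lemma 4.15] -/
theorem symFalseRaw_eq (n : ℕ) : symFalseRaw = symBP (RawBP.falseBDD (Fin n)) Fin.val := by
  funext r c
  unfold symFalseRaw symBP
  congr 1
  by_cases hr : r = 0
  · simp only [hr, if_true]
    have : (RawBP.falseBDD (Fin n)).root.val = 0 := rfl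
    rw [this]
    by_cases hc : c = 0
    · subst hc; simp
    · rw [if_neg hc, if_neg (by omega)]
  · rw [if_neg hr, if_neg hr]
    by_cases hr' : r ≤ 1 ∧ 0 < r
    · rw [dif_pos hr']
      have : (RawBP.falseBDD (Fin n)).node ⟨1 - r, by omega⟩ = .leaf false := rfl
      rw [this]
      simp [symNode]
    · rw [dif_neg hr']

/-- `sizeRaw` is the size of the compiled program. [folklore] -/
theorem sizeRaw_eq (n : ℕ) (B : RawBP) : sizeRaw n B = (RawBP.compile n B).1 := by
  unfold sizeRaw RawBP.compile
  by_cases hv : RawBP.Valid n B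
  · rw [(validRaw_eq_true_iff n B).2 hv, dif_pos hv]; rfl
  · rw [(validRaw_eq_false_iff n B).2 hv, dif_neg hv]; rfl

/-- **The raw block is the AIK encoding of the compiled program.**
[cite: ApplebaumIshaiKushilevitz2006, Lemma 4.15] -/
theorem encodeBDDRaw_eq (n₀ n : ℕ) (B : RawBP) :
    encodeBDDRaw n₀ n B = encodeBDD n₀ (RawBP.compile n B).2 Fin.val := by
  unfold encodeBDDRaw RawBP.compile encodeBDD
  by_cases hv : RawBP.Valid n B
  · rw [(validRaw_eq_true_iff n B).2 hv, dif_pos hv, symBPRaw_eq B hv]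
    rfl
  · rw [(validRaw_eq_false_iff n B).2 hv, dif_neg hv, symFalseRaw_eq n]
    rfl

/-- **The raw list encoding is the AIK encoding of the compiled programs** (same counter, same
outputs). [cite: ApplebaumIshaiKushilevitz2006, Lemma 4.9] -/
theorem encodeBDDsRaw_eq (n n₀ : ℕ) (Bs : List RawBP) :
    encodeBDDsRaw n n₀ Bs = encodeBDDs Fin.val n₀ (compileAll n Bs) := by
  induction Bs generalizing n₀ with
  | nil => rfl
  | cons B Bs ih =>
    simp only [encodeBDDsRaw, compileAll, List.map_cons, encodeBDDs]
    rw [sizeRaw_eq, encodeBDDRaw_eq, ih]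
    rfl

/-- **The untyped data of the instance map `toPEA` is the raw instance map `toPEARaw`.**
[cite: DvirGutfreundRothblumVadhan2010, Thm 4.6] -/
theorem rawOf_toPEA (I : PEABPInst) :
    ((PEABPInst.toPEA I).1, natOf (PEABPInst.toPEA I).2.1, (PEABPInst.toPEA I).2.2) = toPEARaw I := by
  have h1 : (encodeBDDsRaw I.1 I.1 I.2.1).1 = I.1 + I.fresh := by
    rw [encodeBDDsRaw_eq]; exact encodeBDDs_fst_eq _
  have h2 : (encodeBDDsRaw I.1 I.1 I.2.1).2 = natOf (PEABPInst.toPEA I).2.1 := by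
    rw [encodeBDDsRaw_eq]
    exact (natOf_toFinMap _ _ _).symm
  unfold toPEARaw
  rw [h1, h2, Nat.add_sub_cancel_left]
  rfl

/-- The `CodeFP` code of raw nodes. [AroraBarak2009, §0.1] -/
abbrev nodeE : ℕ × ℕ × ℕ × ℕ → List Bool := pairE natE (pairE natE (pairE natE natE))

/-- The `CodeFP` code of `PEABP` instances. [AroraBarak2009, §0.1] -/
abbrev peabpE : ℕ × List (List (ℕ × ℕ × ℕ × ℕ)) × ℕ → List Bool :=
  pairE natE (pairE (listE (listE nodeE)) natE)

/-- The `CodeFP` code of `PEDBP` instances. [AroraBarak2009, §0.1] -/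
abbrev pedbpE : (ℕ × List (List (ℕ × ℕ × ℕ × ℕ))) × (ℕ × List (List (ℕ × ℕ × ℕ × ℕ))) → List Bool :=
  pairE (pairE natE (listE (listE nodeE))) (pairE natE (listE (listE nodeE)))

/-- The `CodeFP` code of `PEA` instances (untyped). [AroraBarak2009, §0.1] -/
abbrev peaE : ℕ × List (List (List ℕ)) × ℕ → List Bool :=
  pairE natE (pairE (listE (listE (listE natE))) natE)

/-- The code of a raw program list is the `CodeFP` headed-list code. [AroraBarak2009, §0.1] -/
theorem rawBP_listBool_encode_eq :
    (RawBP.encoding.listBool.encode : List RawBP → List Bool) = listE (listE nodeE) := by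
  rw [CodeFP.listE_eq, RawBP.encoding, CodeFP.listE_eq, RawBPNode.encoding, CodeFP.pairE_eq,
    CodeFP.pairE_eq, CodeFP.pairE_eq, CodeFP.natE_eq]

/-- **The code of a `PEABP` instance is the `CodeFP` tuple code.** [AroraBarak2009, §0.1] -/
theorem encode_eq_peabpE (I : PEABPInst) : PEABPInst.encoding.encode I = peabpE I := by
  have h : (PEABPInst.encoding.encode : PEABPInst → List Bool) = peabpE := by
    rw [PEABPInst.encoding, CodeFP.pairE_eq, CodeFP.pairE_eq, rawBP_listBool_encode_eq,
      CodeFP.natE_eq]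
  rw [h]

/-- **The code of a `PEDBP` instance is the `CodeFP` tuple code.** [AroraBarak2009, §0.1] -/
theorem encode_eq_pedbpE (I : PEDBPInst) : PEDBPInst.encoding.encode I = pedbpE I := by
  have h : (PEDBPInst.encoding.encode : PEDBPInst → List Bool) = pedbpE := by
    rw [PEDBPInst.encoding, CodeFP.pairE_eq, CodeFP.pairE_eq, rawBP_listBool_encode_eq,
      CodeFP.natE_eq]
  rw [h]

end Bridge

/-! ### §2 `PEABP ≤ₚ PEA 3` -/

/-- **DGRV Thm 4.6 (`PEA` side, deterministic branching programs): entropy approximation for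
branching-program samplers Karp-reduces to `PEA 3`.**
[cite: DvirGutfreundRothblumVadhan2010, Thm 4.6] -/
theorem PEABP_polyTimeReducible_PEA_three : PEABP.PolyTimeReducible (PEA 3) := by
  obtain ⟨F, hF, hFr⟩ := stub_toPEARawFP
  have hred : ∀ I : PEABPInst,
      F (PEABPInst.encoding.encode I) = PEAInst.encoding.encode (PEABPInst.toPEA I) := by
    intro I
    rw [encode_eq_peabpE, hFr, encode_eq_instE, rawOf_toPEA]
  refine ⟨F, hF, fun w hw => ?_, fun w hw => ?_⟩
  · have hw' := hw
    obtain ⟨I, -, rfl⟩ : ∃ I, I ∈ _ ∧ PEABPInst.encoding.encode I = w := hw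
    rw [hred]
    exact PEABPInst.toPEA_mem_yes hw'
  · have hw' := hw
    obtain ⟨I, -, rfl⟩ : ∃ I, I ∈ _ ∧ PEABPInst.encoding.encode I = w := hw
    rw [hred]
    exact PEABPInst.toPEA_mem_no hw'

/-! ### §3 `PEA d ≤ₚ PEABP`: parity programs preserve the output entropy -/

/-- Recoding an `F₂`-string bitwise as Booleans is injective. [folklore] -/
theorem map_decide_eq_one_injective :
    Function.Injective (fun l : List (ZMod 2) => l.map fun v => decide (v = 1)) := by
  intro l l' h
  have hinj : Function.Injective (fun v : ZMod 2 => decide (v = 1)) := by decide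
  exact (List.map_injective_iff.2 hinj) h

/-- **The parity programs of a sparse map sample the same distribution up to the bitwise recoding
`F₂ ≃ Bool`**: `bpMap = (decide (· = 1))^* ∘ P.eval`. [Wegener 2000, §1.1] [folklore] -/
theorem bpMap_parityRaw {n : ℕ} (P : PolyMapF2 n) :
    bpMap n ((natOf P).map parityRaw) = fun x => (P.eval x).map fun v => decide (v = 1) := by
  funext x
  simp only [bpMap, fnList, compileAll, natOf, List.map_map, Function.comp_def, PolyMapF2.eval]
  refine List.map_congr_left fun p _ => ?_
  exact stub_parityRaw_fn p x

/-- **The parity programs have the output entropy of the map**: `H(bpMap) = H(P(U_n))`.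
[cite: DvirGutfreundRothblumVadhan2010, §3 p.6] -/
theorem bpEntropy_parityRaw {n : ℕ} (P : PolyMapF2 n) :
    bpEntropy n ((natOf P).map parityRaw) = P.entropy := by
  unfold bpEntropy PolyMapF2.entropy
  rw [bpMap_parityRaw]
  exact Literature.InformationTheory.Entropy.mapEntropy_comp_of_injOn P.eval
    (fun l : List (ZMod 2) => l.map fun v => decide (v = 1))
    fun a _ b _ h => map_decide_eq_one_injective h

/-- **Sparse polynomial maps are branching-program samplers: `PEA d ≤ₚ PEABP` for every `d`**
(the degree promise is not used). [Wegener 2000, §1.1; DGRV 2010, §3] [cite: DvirGutfreundRothblumVadhan2010, §3 p.6] -/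
theorem PEA_polyTimeReducible_PEABP (d : ℕ) : (PEA d).PolyTimeReducible PEABP := by
  obtain ⟨F, hF, hFr⟩ := stub_toPEABPRawFP
  have hred : ∀ I : PEAInst, F (PEAInst.encoding.encode I) =
      PEABPInst.encoding.encode ((I.1, (natOf I.2.1).map parityRaw, I.2.2) : PEABPInst) := by
    intro I
    rw [encode_eq_instE, hFr, encode_eq_peabpE]
    rfl
  refine ⟨F, hF, fun w hw => ?_, fun w hw => ?_⟩
  · have hw' := hw
    obtain ⟨I, -, rfl⟩ : ∃ I, I ∈ _ ∧ PEAInst.encoding.encode I = w := hw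
    rw [hred]
    have hw2 := (encode_mem_PEA_yes_iff d I).1 hw'
    refine (encode_mem_PEABP_yes_iff _).2 ?_
    change (I.2.2 : ℝ) + 1 ≤ bpEntropy I.1 ((natOf I.2.1).map parityRaw)
    rw [bpEntropy_parityRaw]
    exact hw2.2
  · have hw' := hw
    obtain ⟨I, -, rfl⟩ : ∃ I, I ∈ _ ∧ PEAInst.encoding.encode I = w := hw
    rw [hred]
    have hw2 := (encode_mem_PEA_no_iff d I).1 hw'
    refine (encode_mem_PEABP_no_iff _).2 ?_
    change bpEntropy I.1 ((natOf I.2.1).map parityRaw) ≤ (I.2.2 : ℝ)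
    rw [bpEntropy_parityRaw]
    exact hw2.2

/-! ### §4 The crux is exactly the hardness of `PEABP` -/

/-- **`PEABP ∈ PromiseP ↔ PEA 3 ∈ PromiseP`** (entropy approximation for branching-program samplers
and for sparse cubic maps are Karp-inter-reducible). [cite: DvirGutfreundRothblumVadhan2010, Thm 4.6] -/
theorem PEABP_mem_PromiseP_iff : PEABP ∈ PromiseP ↔ PEA 3 ∈ PromiseP :=
  ⟨fun h => PromiseProblem.mem_PromiseP_of_polyTimeReducible_holds (PEA_polyTimeReducible_PEABP 3) h,
    fun h => PromiseProblem.mem_PromiseP_of_polyTimeReducible_holds PEABP_polyTimeReducible_PEA_three h⟩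

/-- **The crux `PeaThreeNotInP` is EXACTLY the statement that entropy approximation (to within one
bit, Shannon entropy of the output on a uniform input) for maps given by deterministic branching
programs is not in promise-`P`.** [cite: DvirGutfreundRothblumVadhan2010, Thm 4.6] -/
theorem peaThreeNotInP_iff_PEABP_not_mem : PeaThreeNotInP ↔ PEABP ∉ PromiseP := by
  rw [szkEntropy_peaThreeNotInP_iff, PEABP_mem_PromiseP_iff]

/-- Socket form: hardness of `PEABP` gives the crux. [cite: DvirGutfreundRothblumVadhan2010, Thm 4.6] -/
theorem peaThreeNotInP_of_PEABP_not_mem (h : PEABP ∉ PromiseP) : PeaThreeNotInP :=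
  peaThreeNotInP_iff_PEABP_not_mem.2 h

/-! ### §5 `PEDBP ≤ₚ PED 3` and the entropy-difference socket -/

/-- The identity map as naturals. [folklore] -/
theorem natOf_idMap (m : ℕ) : natOf (PolyMapF2.idMap m) = idMapRaw m := by
  simp only [natOf, PolyMapF2.idMap, idMapRaw, List.map_map, Function.comp_def, List.map_cons,
    List.map_nil]
  rw [← List.map_coe_finRange_eq_range, List.map_map]
  rfl

/-- **The untyped data of `toPED` is `toPEDRaw`.** [cite: DvirGutfreundRothblumVadhan2010, Thm 4.6] -/
theorem rawPED_toPED (I : PEDBPInst) : rawPED (toPED I) = toPEDRaw I := by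
  have hN : ∀ (n : ℕ) (Bs : List RawBP), (encodeBDDsRaw n n Bs).1 = n + freshBDDs (compileAll n Bs) :=
    fun n Bs => by rw [encodeBDDsRaw_eq]; exact encodeBDDs_fst_eq _
  have hP : ∀ (n : ℕ) (Bs : List RawBP),
      (encodeBDDsRaw n n Bs).2 = natOf (encodeBDDsMap n (compileAll n Bs)) :=
    fun n Bs => by rw [encodeBDDsRaw_eq]; exact (natOf_toFinMap _ _ _).symm
  unfold toPEDRaw rawPED toPED prodRaw
  simp only [hN, hP, Nat.add_sub_cancel_left, natOf_prod, natOf_idMap]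
  rfl

/-- **DGRV Thm 4.6 (deterministic branching programs): entropy difference for branching-program
samplers Karp-reduces to `PED_{F₂,3}`.** [cite: DvirGutfreundRothblumVadhan2010, Thm 4.6] -/
theorem PEDBP_polyTimeReducible_PED_three : PEDBP.PolyTimeReducible (PED 3) := by
  obtain ⟨F, hF, hFr⟩ := stub_toPEDRawFP stub_encodeBDDsRawFP
  have hred : ∀ I : PEDBPInst,
      F (PEDBPInst.encoding.encode I) = PEDInst.encoding.encode (toPED I) := by
    intro I
    rw [encode_eq_pedbpE, hFr, encode_eq_pedE, rawPED_toPED]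
  refine ⟨F, hF, fun w hw => ?_, fun w hw => ?_⟩
  · have hw' := hw
    obtain ⟨I, -, rfl⟩ : ∃ I, I ∈ _ ∧ PEDBPInst.encoding.encode I = w := hw
    rw [hred]
    exact stub_toPED_mem.1 I hw'
  · have hw' := hw
    obtain ⟨I, -, rfl⟩ : ∃ I, I ∈ _ ∧ PEDBPInst.encoding.encode I = w := hw
    rw [hred]
    exact stub_toPED_mem.2 I hw'

/-- **Entropy-difference socket: hardness of `PEDBP` gives the crux** (via `PEDBP ≤ₚ PED 3` and the
landed `PED 3 ≤_Cook PEA 3`).  Any promise problem with a certified one-bit entropy-difference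
presentation by branching-program samplers plugs in here.
[cite: DvirGutfreundRothblumVadhan2010, Thm 4.6] -/
theorem peaThreeNotInP_of_PEDBP_not_mem (h : PEDBP ∉ PromiseP) : PeaThreeNotInP := by
  rw [szkEntropy_peaThreeNotInP_iff]
  intro h3
  exact h (PromiseProblem.mem_PromiseP_of_polyTimeReducible_holds PEDBP_polyTimeReducible_PED_three
    (PromiseProblem.mem_PromiseP_of_cookReducible_holds _ _ (stub_pedCookPea 3) h3))

/-- **Randomised form**: if `PEDBP ∉ PromiseBPP'` then `PEA 3 ∉ PromiseBPP'` (`¬ PeaThreeMemBPP`),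
hence (kill-switch exhaustiveness) the crux. [cite: DvirGutfreundRothblumVadhan2010, Thm 4.6] -/
theorem not_peaThreeMemBPP_of_PEDBP (h : PEDBP ∉ PromiseBPP') : ¬ PeaThreeMemBPP := by
  rw [szkEntropy_peaThreeMemBPP_iff]
  intro h3
  exact h (PromiseProblem.mem_PromiseBPP'_of_polyTimeReducible_holds' PEDBP_polyTimeReducible_PED_three
    (PromiseProblem.mem_PromiseBPP'_of_cookReducible_holds _ _ (stub_pedCookPea 3) h3))

end Summit.PneNP.PneNP.Cruxes.PeaThreeNotInP.SocketBP
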